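import Literature.Computability.MetaComplexity.SliceLowerBoundVerifier
import Literature.Computability.MetaComplexity.LanguageCompressionBounds
import Literature.Computability.Complexity.HashHitBlocks
import HarnessLib

/-!
# Complexity meta: the Goldwasser–Sipser lower-bound language for the slices `L_t` is in `NP` (Hirahara 2021, Lemma 4.5), II

Topic `Literature/Computability/MetaComplexity`, continuation of `SliceLowerBoundVerifier.lean`
(inline proof plan of `Hirahara2021_languageCompression`; S. Hirahara, ECCC TR21-058 (2021),
proof of Lemma 4.5, p. 27: "Let `L' := {(r, 1^{⟨t,k⟩}) | ∃ y ∈ {0,1}^{p(t)}, V((1ᵗ, 2ᵏ), y, r) = 1}`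
… Observe that `{L'_{⟨t,k⟩}}` is in `NP`"). Here `V` is the amplified bit-level set lower-bound test
of `HashHitBlocks.lean`: `u(t) = 128(t+1)` blocks of `B(t,κ) = (κ+1)(M(t)+1)` coins, a block *hits*
if some padded member of `L_t` hashes to `0^{κ+1}` under it, and `V` accepts iff at least
`θ(t) = 40(t+1) = (5/16)u(t)` blocks hit.

* `SLB.sliceVec L P t` — the padded slice `{pad_P(x) | x ∈ L_t, |x| ≤ P} ⊆ {0,1}^{P+1}` as a finset
  of bit vectors, `card_sliceVec` (`= |L_t|` when `L_t ⊆ {0,1}^{≤ P}`, by `pad_injective`);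
* `SLB.gsLang L pL` — the language `{(r, 1^{⟨t,κ⟩}) : |r| = u(t)B(t,κ), θ(t) ≤ #hitting blocks}`;
* the verifier `SLB.verF` (well-formedness checks and the count `|runFold appF pieceF|` of valid
  pieces against `θ(t)`), `verF_mem_FP`, its value (`verF_eq_true_iff`), and **`gsLang_mem_NP`**.

## References

* S. Hirahara, ECCC TR21-058 (2021), Lemma 4.5, Lemma 4.6 and their proofs (pp. 26–28) [Hirahara2021].
* S. Arora, B. Barak, *Computational Complexity: A Modern Approach*, CUP 2009, §8.2.2, Def. 2.1, §1.3
  [AroraBarakCC2009].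
-/

noncomputable section

namespace Literature.Computability.MetaComplexity

open _root_.Computability Polynomial Complexity Complexity.Classes Complexity.Nondeterministic Complexity.Brick
  Complexity.Plumb Complexity.HashBricks Complexity.LenCmp Complexity.Stockmeyer Finset

namespace SLB

open scoped Classical

/-! ### The padded slice and the language -/

/-- The padded slice: `{pad_P(x) | x ∈ L_t, |x| ≤ P}` as bit vectors of length `P + 1`. [cite: Hirahara2021, Lemma 4.5 (proof: "S := L_t")] -/
def sliceVec (L : Language Bool) (P t : ℕ) : Finset (List.Vector Bool (P + 1)) :=
  univ.filter fun w => ∃ x ∈ languageSlice L t, x.length ≤ P ∧ w.toList = pad P x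

/-- Membership in the padded slice. [folklore] -/
theorem mem_sliceVec_iff {L : Language Bool} {P t : ℕ} (w : List.Vector Bool (P + 1)) :
    w ∈ sliceVec L P t ↔ ∃ x ∈ languageSlice L t, x.length ≤ P ∧ w.toList = pad P x := by
  simp [sliceVec]

/-- **`|sliceVec| = |L_t|`** when every member of `L_t` has length `≤ P`. [folklore] -/
theorem card_sliceVec {L : Language Bool} {P t : ℕ} (hP : ∀ x ∈ languageSlice L t, x.length ≤ P) :
    (sliceVec L P t).card = (languageSlice L t).ncard := by
  have hfin : (languageSlice L t).Finite := (List.finite_length_le Bool P).subset fun x hx => hP x hx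
  rw [Set.ncard_eq_toFinset_card _ hfin]
  symm
  refine card_bij (fun x hx => (⟨pad P x, length_pad (hP x (hfin.mem_toFinset.1 hx))⟩ : List.Vector Bool (P + 1)))
    (fun x hx => ?_) (fun x₁ hx₁ x₂ hx₂ h => ?_) (fun w hw => ?_)
  · rw [mem_sliceVec_iff]
    exact ⟨x, hfin.mem_toFinset.1 hx, hP x (hfin.mem_toFinset.1 hx), rfl⟩
  · exact pad_injective (congr_arg List.Vector.toList h)
  · obtain ⟨x, hx, -, hw'⟩ := (mem_sliceVec_iff w).1 hw
    exact ⟨x, hfin.mem_toFinset.2 hx, List.Vector.toList_injective hw'.symm⟩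

variable (L : Language Bool) (pL : Polynomial ℕ)

/-- **The lower-bound language of the slices** (Hirahara's `L'`): pairs `(r, 1^{⟨t,κ⟩})` with
`|r| = u(t) B(t,κ)` such that at least `θ(t)` of the `u(t)` coin blocks of `r` hash some padded
member of `L_t` to `0^{κ+1}`. [cite: Hirahara2021, Lemma 4.5 (proof, the language L')] -/
def gsLang : Language Bool :=
  {v | ∃ r : List Bool, ∃ t κ : ℕ, v = paramEnc (r, Nat.pair t κ) ∧ r.length = tests t * blkLen pL t κ ∧
    thresh t ≤ hitBlocks (sliceVec L (pL.eval t) t) (κ + 1) (blkLen pL t κ) (tests t) r}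

variable {L pL}

/-- Membership of a well-formed instance. [folklore] -/
theorem paramEnc_mem_gsLang_iff (r : List Bool) (t κ : ℕ) :
    paramEnc (r, Nat.pair t κ) ∈ gsLang L pL ↔ r.length = tests t * blkLen pL t κ ∧
      thresh t ≤ hitBlocks (sliceVec L (pL.eval t) t) (κ + 1) (blkLen pL t κ) (tests t) r := by
  constructor
  · rintro ⟨r', t', κ', h, hlen, hθ⟩
    have h1 := boolPair_injective (a₁ := (r, _)) (a₂ := (r', _)) h
    simp only [Prod.mk.injEq] at h1
    obtain ⟨rfl, h2⟩ := h1
    have hm : Nat.pair t κ = Nat.pair t' κ' := by simpa using congr_arg unaryDecodeNat h2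
    obtain ⟨rfl, rfl⟩ := Nat.pair_eq_pair.1 hm
    exact ⟨hlen, hθ⟩
  · rintro ⟨hlen, hθ⟩
    exact ⟨r, t, κ, rfl, hlen, hθ⟩

/-! ### The validity predicate of an item and its consequences -/

section Valid

variable (R : Language Bool) (pL pL' : Polynomial ℕ) (r : List Bool) (t κ : ℕ) (items : List Bool)

/-- **Item `j` is valid**: with `⟨y, c⟩ = item_j`, `|y| ≤ p_L(t)`, `pad(y)` hashes to `0^{κ+1}` under
block `j` of `r`, and `c` certifies `(y, 1ᵗ) ∈ L` for the verifier `(R, p_L')` (a predicate of the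
block index `j`, not a named fact). [cite: Hirahara2021, Lemma 4.6 (proof sketch)] -/
def Valid (j : ℕ) : Prop :=
  (fstF (nthItemFn (boolPair (ones j) items))).length ≤ pL.eval t ∧
    HashesToZero ((r.drop (j * blkLen pL t κ)).take (blkLen pL t κ)) (memLen pL t) (κ + 1)
      (pad (pL.eval t) (fstF (nthItemFn (boolPair (ones j) items)))) ∧
    boolPair (paramEnc (fstF (nthItemFn (boolPair (ones j) items)), t)) (sndF (nthItemFn (boolPair (ones j) items))) ∈ R ∧
    (sndF (nthItemFn (boolPair (ones j) items))).length ≤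
      pL'.eval (paramEnc (fstF (nthItemFn (boolPair (ones j) items)), t)).length

/-- The number of valid items among the first `u`. [folklore] -/
def validCount (u : ℕ) : ℕ := (univ.filter fun j : Fin u => Valid R pL pL' r t κ items j).card

end Valid

/-- **A valid item is a hit**: if the verifier `(R, p_L')` decides `L`, a valid item `j` exhibits a
padded member of `L_t` hashed to zero by block `j`. [cite: Hirahara2021, Lemma 4.6 (soundness of the lower bound protocol)] -/
theorem hitZero_of_valid {L R : Language Bool} {pL pL' : Polynomial ℕ}
    (hLR : ∀ v, v ∈ L ↔ ∃ c : List Bool, c.length ≤ pL'.eval v.length ∧ boolPair v c ∈ R)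
    {r : List Bool} {t κ : ℕ} {items : List Bool} {j : ℕ} (hv : Valid R pL pL' r t κ items j) :
    HitZero (sliceVec L (pL.eval t) t) (κ + 1) ((r.drop (j * blkLen pL t κ)).take (blkLen pL t κ)) := by
  obtain ⟨hy, hh, hR, hc⟩ := hv
  set y := fstF (nthItemFn (boolPair (ones j) items))
  have hyL : y ∈ languageSlice L t := mem_languageSlice_iff.2 ((hLR _).2 ⟨_, hc, hR⟩)
  refine ⟨⟨pad (pL.eval t) y, length_pad hy⟩, (mem_sliceVec_iff _).2 ⟨y, hyL, hy, rfl⟩, ?_⟩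
  simpa [memLen] using hh

/-- Hence **the valid items are at most the hitting blocks**. [cite: Hirahara2021, Lemma 4.6 (soundness)] -/
theorem validCount_le_hitBlocks {L R : Language Bool} {pL pL' : Polynomial ℕ}
    (hLR : ∀ v, v ∈ L ↔ ∃ c : List Bool, c.length ≤ pL'.eval v.length ∧ boolPair v c ∈ R)
    (r : List Bool) (t κ : ℕ) (items : List Bool) (u : ℕ) :
    validCount R pL pL' r t κ items u ≤ hitBlocks (sliceVec L (pL.eval t) t) (κ + 1) (blkLen pL t κ) u r := by
  unfold validCount hitBlocks
  exact card_le_card fun j hj => by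
    simp only [mem_filter, mem_univ, true_and] at hj ⊢
    exact hitZero_of_valid hLR hj

/-- **Completeness of the items**: if the verifier `(R, p_L')` decides `L`, there is a list of items,
one per block, valid exactly where... at least at every hitting block; so the valid items number at
least the hitting blocks, and the coded list has polynomial length. [cite: Hirahara2021, Lemma 4.6 (completeness: "the prover sends y ∈ S with h(y) = 0 and its certificate")] -/
theorem exists_items {L R : Language Bool} {pL pL' : Polynomial ℕ}
    (hLR : ∀ v, v ∈ L ↔ ∃ c : List Bool, c.length ≤ pL'.eval v.length ∧ boolPair v c ∈ R)
    (r : List Bool) (t κ u : ℕ) :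
    ∃ l : List (List Bool), l.length = u ∧
      (∀ a ∈ l, a.length ≤ 2 * pL.eval t + 2 + pL'.eval (2 * pL.eval t + 2 + t)) ∧
      hitBlocks (sliceVec L (pL.eval t) t) (κ + 1) (blkLen pL t κ) u r ≤ validCount R pL pL' r t κ (encList l) u := by
  -- the item of block `j`
  have hitem : ∀ j : ℕ, ∃ a : List Bool, a.length ≤ 2 * pL.eval t + 2 + pL'.eval (2 * pL.eval t + 2 + t) ∧
      (HitZero (sliceVec L (pL.eval t) t) (κ + 1) ((r.drop (j * blkLen pL t κ)).take (blkLen pL t κ)) →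
        (fstF a).length ≤ pL.eval t ∧
        HashesToZero ((r.drop (j * blkLen pL t κ)).take (blkLen pL t κ)) (memLen pL t) (κ + 1) (pad (pL.eval t) (fstF a)) ∧
        boolPair (paramEnc (fstF a, t)) (sndF a) ∈ R ∧ (sndF a).length ≤ pL'.eval (paramEnc (fstF a, t)).length) := by
    intro j
    by_cases hh : HitZero (sliceVec L (pL.eval t) t) (κ + 1) ((r.drop (j * blkLen pL t κ)).take (blkLen pL t κ))
    · obtain ⟨w, hw, h0⟩ := hh
      obtain ⟨y, hyL, hyP, hwy⟩ := (mem_sliceVec_iff w).1 hw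
      obtain ⟨c, hc, hRc⟩ := (hLR _).1 (mem_languageSlice_iff.1 hyL)
      have hlenv : (paramEnc (y, t)).length = 2 * y.length + 2 + t := by
        simp [paramEnc, ParamUniform.length_unaryEncodeNat]
      refine ⟨boolPair y c, ?_, fun _ => ?_⟩
      · rw [length_boolPair]
        rw [hlenv] at hc
        have hmono := LCBounds.eval_mono pL' (show 2 * y.length + 2 + t ≤ 2 * pL.eval t + 2 + t by omega)
        omega
      · simp only [fstF_boolPair, sndF_boolPair]
        refine ⟨hyP, ?_, hRc, hc⟩
        rw [← hwy]; simpa [memLen] using h0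
    · exact ⟨[], by simp, fun h => absurd h hh⟩
  choose item hlen hval using hitem
  refine ⟨List.ofFn fun j : Fin u => item j, by simp, fun a ha => ?_, ?_⟩
  · obtain ⟨j, rfl⟩ := List.mem_ofFn.1 ha
    exact hlen j
  · unfold validCount hitBlocks
    refine card_le_card fun j hj => ?_
    simp only [mem_filter, mem_univ, true_and] at hj ⊢
    have hget : nthItemFn (boolPair (ones j) (encList (List.ofFn fun j : Fin u => item j))) = item j := by
      rw [nthItemFn_encList, List.getD_eq_getElem?_getD, List.getElem?_ofFn]
      simp [j.isLt]
    unfold Valid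
    rw [hget]
    exact hval j hj

/-! ### The verifier -/

section Verifier

variable (pL : Polynomial ℕ) (rTest : List Bool → List Bool) (pL' : Polynomial ℕ)

/-! Parsers on `w = ⟨v, W⟩`, `v = ⟨r, 1^m⟩`, `W = ⟨1ᵗ, ⟨1^κ, items⟩⟩` (total; unary fields normalised). -/

/-- `v`. [folklore] -/
def vW : List Bool → List Bool := fstF
/-- `r`. [folklore] -/
def rW : List Bool → List Bool := fstF ∘ fstF
/-- `1^m`. [folklore] -/
def mW : List Bool → List Bool := onesFn ∘ sndF ∘ fstF
/-- `1ᵗ`. [folklore] -/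
def tW : List Bool → List Bool := onesFn ∘ fstF ∘ sndF
/-- `1^κ`. [folklore] -/
def kW : List Bool → List Bool := onesFn ∘ fstF ∘ sndF ∘ sndF
/-- `items`. [folklore] -/
def itemsW : List Bool → List Bool := sndF ∘ sndF ∘ sndF
/-- `1^{u(t)}`. [folklore] -/
def uW : List Bool → List Bool := polyFn (128 * (X + 1)) ∘ tW
/-- `1^{θ(t)}`. [folklore] -/
def thW : List Bool → List Bool := polyFn (40 * (X + 1)) ∘ tW
/-- `1^{B(t,κ)}`. [folklore] -/
def BW : List Bool → List Bool :=
  umulFn ∘ fanoutFn (List.cons true ∘ kW) (List.cons true ∘ List.cons true ∘ polyFn pL ∘ tW)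

/-- Check `v = ⟨r, 1^m⟩` (canonical instance). [folklore] -/
def d0 : List Bool → List Bool := eqPairFn ∘ fanoutFn (fanoutFn rW mW) vW
/-- Check `W = ⟨1ᵗ, ⟨1^κ, items⟩⟩` (canonical certificate). [folklore] -/
def dW : List Bool → List Bool := eqPairFn ∘ fanoutFn (fanoutFn tW (fanoutFn kW itemsW)) sndF
/-- Check `m = ⟨t, κ⟩`. [folklore] -/
def d1 : List Bool → List Bool := eqPairFn ∘ fanoutFn mW (pairUF ∘ fanoutFn tW kW)
/-- Check `|r| = u(t) B(t, κ)`. [folklore] -/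
def d2 : List Bool → List Bool := eqPairFn ∘ fanoutFn (onesFn ∘ rW) (umulFn ∘ fanoutFn (uW) (BW pL))
/-- The fold: the concatenation of the `u(t)` pieces (one symbol per valid item). [cite: AroraBarakCC2009, §1.3 (bounded loops)] -/
def foldF : List Bool → List Bool := runFold appF (pieceF pL rTest pL') (fun w => w) uW
/-- Check `θ(t) ≤ #valid items`. [folklore] -/
def d3 : List Bool → List Bool := lenLeFn X ∘ fanoutFn (foldF pL rTest pL') thW

/-- **The verifier.** [cite: Hirahara2021, Lemma 4.5 (proof: "{L'_{⟨t,k⟩}} is in NP")] -/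
def verF : List Bool → List Bool :=
  andFn (d0) (andFn (dW) (andFn (d1) (andFn (d2 pL) (d3 pL rTest pL'))))

variable {pL rTest pL'}

/-- The fold is in `FP`. [cite: AroraBarakCC2009, §1.3] -/
theorem foldF_mem_FP (hrT : rTest ∈ FP) (hr1 : OneBit rTest) : foldF pL rTest pL' ∈ FP := by
  have ht : tW ∈ FP := comp_mem_FP onesFn_mem_FP (comp_mem_FP fstF_mem_FP sndF_mem_FP)
  refine runFold_mem_FP appF_mem_FP X (fun w => by simpa using length_appF_le w) (pieceF_mem_FP hrT) 1
    (fun w => by simpa using length_pieceF_le (pL := pL) (pL' := pL') hr1 w) (PolyTimeComputable.id _)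
    (comp_mem_FP (polyFn_mem_FP _) ht)

/-- **The verifier is in `FP`.** [cite: AroraBarakCC2009, §1.3] -/
theorem verF_mem_FP (hrT : rTest ∈ FP) (hr1 : OneBit rTest) : verF pL rTest pL' ∈ FP := by
  have hv : vW ∈ FP := fstF_mem_FP
  have hr : rW ∈ FP := comp_mem_FP fstF_mem_FP fstF_mem_FP
  have hm : mW ∈ FP := comp_mem_FP onesFn_mem_FP (comp_mem_FP sndF_mem_FP fstF_mem_FP)
  have ht : tW ∈ FP := comp_mem_FP onesFn_mem_FP (comp_mem_FP fstF_mem_FP sndF_mem_FP)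
  have hk : kW ∈ FP := comp_mem_FP onesFn_mem_FP (comp_mem_FP fstF_mem_FP (comp_mem_FP sndF_mem_FP sndF_mem_FP))
  have hi : itemsW ∈ FP := comp_mem_FP sndF_mem_FP (comp_mem_FP sndF_mem_FP sndF_mem_FP)
  have hu : uW ∈ FP := comp_mem_FP (polyFn_mem_FP _) ht
  have hth : thW ∈ FP := comp_mem_FP (polyFn_mem_FP _) ht
  have hB : BW pL ∈ FP := comp_mem_FP umulFn_mem_FP (fanoutFn_mem_FP (comp_mem_FP (cons_mem_FP true) hk)
    (comp_mem_FP (cons_mem_FP true) (comp_mem_FP (cons_mem_FP true) (comp_mem_FP (polyFn_mem_FP pL) ht))))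
  have h0 : d0 ∈ FP := comp_mem_FP eqPairFn_mem_FP (fanoutFn_mem_FP (fanoutFn_mem_FP hr hm) hv)
  have hW : dW ∈ FP := comp_mem_FP eqPairFn_mem_FP (fanoutFn_mem_FP (fanoutFn_mem_FP ht (fanoutFn_mem_FP hk hi)) sndF_mem_FP)
  have h1 : d1 ∈ FP := comp_mem_FP eqPairFn_mem_FP (fanoutFn_mem_FP hm (comp_mem_FP pairUF_mem_FP (fanoutFn_mem_FP ht hk)))
  have h2 : d2 pL ∈ FP := comp_mem_FP eqPairFn_mem_FP (fanoutFn_mem_FP (comp_mem_FP onesFn_mem_FP hr)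
    (comp_mem_FP umulFn_mem_FP (fanoutFn_mem_FP hu hB)))
  have h3 : d3 pL rTest pL' ∈ FP := comp_mem_FP (lenLeFn_mem_FP X) (fanoutFn_mem_FP (foldF_mem_FP hrT hr1) hth)
  exact andFn_mem_FP h0 (andFn_mem_FP hW (andFn_mem_FP h1 (andFn_mem_FP h2 h3)))

/-- The verifier is one-bit. [folklore] -/
theorem oneBit_verF : OneBit (verF pL rTest pL') := by
  have hl : OneBit (d3 pL rTest pL') := fun z => by
    unfold d3; rcases lenLeFn_eq_or X (fanoutFn (foldF pL rTest pL') thW z) with h | h <;> exact ⟨_, h⟩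
  have heq : ∀ f g : List Bool → List Bool, OneBit (eqPairFn ∘ fanoutFn f g) := fun f g w =>
    ⟨_, by rw [Function.comp_apply, fanoutFn_apply, eqPairFn_boolPair]⟩
  unfold verF d0 dW d1 d2
  exact oneBit_andFn (heq _ _) (oneBit_andFn (heq _ _) (oneBit_andFn (heq _ _) (oneBit_andFn (heq _ _) hl)))

/-- Length of a `ccat`: the sum of the lengths of the pieces. [folklore] -/
theorem length_ccat_eq_sum (g : ℕ → List Bool) : ∀ n : ℕ, (ccat g n).length = ∑ j ∈ range n, (g j).length
  | 0 => by simp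
  | n + 1 => by rw [ccat_succ, List.length_append, length_ccat_eq_sum g n, sum_range_succ]

/-- **Value of the fold** on a canonical record: the number of valid items among the first `u(t)`.
[cite: Hirahara2021, Lemma 4.5 (proof)] -/
theorem length_foldF {R : Language Bool} (hr : ∀ v, rTest v = [R.boolIndicator v]) (r : List Bool) (m t κ : ℕ)
    (items : List Bool) (hm : tests t ≤ r.length) :
    (foldF pL rTest pL' (boolPair (paramEnc (r, m)) (boolPair (ones t) (boolPair (ones κ) items)))).length =
      validCount R pL pL' r t κ items (tests t) := by
  set w := boolPair (paramEnc (r, m)) (boolPair (ones t) (boolPair (ones κ) items)) with hw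
  have htW : tW w = ones t := by simp [tW, hw, onesFn, ParamUniform.unaryEncodeNat_eq_ones]
  have huW : uW w = ones (tests t) := by
    rw [uW, Function.comp_apply, htW, polyFn_apply]; simp [tests]
  have hlenw : (uW w).length ≤ ((fun w' : List Bool => w') w).length := by
    rw [huW, ParamUniform.length_ones, hw]
    simp only [length_boolPair, paramEnc, ParamUniform.length_unaryEncodeNat]
    omega
  unfold foldF
  rw [runFold_apply _ _ _ _ hlenw, huW, ParamUniform.length_ones, foldAcc_appF, List.nil_append, length_ccat_eq_sum]
  simp only [zero_add]
  have hpiece : ∀ j, (pieceF pL rTest pL' (boolPair w (ones j))).length = if Valid R pL pL' r t κ items j then 1 else 0 := by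
    intro j
    rw [show boolPair w (ones j) = arg r m t κ items j from rfl, pieceF_arg hr r m t κ items j (Valid R pL pL' r t κ items j) Iff.rfl]
    split_ifs <;> rfl
  simp only [hpiece]
  rw [validCount, Finset.card_eq_sum_ones, ← Fin.sum_univ_eq_sum_range, Finset.sum_filter]

/-- **Value of the verifier**: `verF ⟨v, W⟩ = [1]` iff `v = (r, 1^{⟨t,κ⟩})`, `W = ⟨1ᵗ, ⟨1^κ, items⟩⟩`,
`|r| = u(t)B(t,κ)` and at least `θ(t)` items are valid. [cite: Hirahara2021, Lemma 4.5 (proof)] -/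
theorem verF_eq_true_iff {R : Language Bool} (hr : ∀ v, rTest v = [R.boolIndicator v]) (v W : List Bool) :
    verF pL rTest pL' (boolPair v W) = [true] ↔
      ∃ (r : List Bool) (t κ : ℕ) (items : List Bool), v = paramEnc (r, Nat.pair t κ) ∧
        W = boolPair (ones t) (boolPair (ones κ) items) ∧ r.length = tests t * blkLen pL t κ ∧
        thresh t ≤ validCount R pL pL' r t κ items (tests t) := by
  set w := boolPair v W with hw
  have hones := ParamUniform.unaryEncodeNat_eq_ones
  -- parser values
  have hv : vW w = v := by simp [vW, hw]
  have hrW : rW w = fstF v := by simp [rW, hw]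
  have hmW : mW w = ones (sndF v).length := by simp [mW, hw, onesFn, hones]
  have htW : tW w = ones (fstF W).length := by simp [tW, hw, onesFn, hones]
  have hkW : kW w = ones (fstF (sndF W)).length := by simp [kW, hw, onesFn, hones]
  have hiW : itemsW w = sndF (sndF W) := by simp [itemsW, hw]
  set t := (fstF W).length with ht
  set κ := (fstF (sndF W)).length with hκ
  have huW : uW w = ones (tests t) := by rw [uW, Function.comp_apply, htW, polyFn_apply]; simp [tests]
  have hthW : thW w = ones (thresh t) := by rw [thW, Function.comp_apply, htW, polyFn_apply]; simp [thresh]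
  have hBW : BW pL w = ones (blkLen pL t κ) := by
    rw [BW, Function.comp_apply, fanoutFn_apply]
    simp only [Function.comp_apply]
    rw [hkW, htW, polyFn_apply, ParamUniform.length_ones,
      show true :: ones κ = ones (κ + 1) by simp [ones, List.replicate_succ],
      show true :: true :: ones (pL.eval t) = ones (memLen pL t + 1) by simp [ones, memLen, List.replicate_succ],
      umulFn_boolPair, blkLen]
  -- values of the checks
  have c0 : d0 w = [decide (boolPair (fstF v) (ones (sndF v).length) = v)] := by
    rw [d0, Function.comp_apply, fanoutFn_apply, fanoutFn_apply, hrW, hmW, hv, eqPairFn_boolPair]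
  have cW : dW w = [decide (boolPair (ones t) (boolPair (ones κ) (sndF (sndF W))) = W)] := by
    rw [dW, Function.comp_apply, fanoutFn_apply, fanoutFn_apply, fanoutFn_apply, htW, hkW, hiW, eqPairFn_boolPair]
    simp [hw]
  have c1 : d1 w = [decide ((sndF v).length = Nat.pair t κ)] := by
    rw [d1, Function.comp_apply, fanoutFn_apply, hmW, Function.comp_apply, fanoutFn_apply, htW, hkW, pairUF_boolPair,
      eqPairFn_boolPair]
    simp [ones]
  have c2 : d2 pL w = [decide ((fstF v).length = tests t * blkLen pL t κ)] := by
    rw [d2, Function.comp_apply, fanoutFn_apply, Function.comp_apply, hrW, Function.comp_apply, fanoutFn_apply, huW, hBW,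
      umulFn_boolPair, eqPairFn_boolPair]
    simp [onesFn, hones, ones]
  have c3 : d3 pL rTest pL' w = [decide (thresh t ≤ (foldF pL rTest pL' w).length)] := by
    rw [d3, Function.comp_apply, fanoutFn_apply, hthW, lenLeFn_boolPair, ParamUniform.length_ones, eval_X]
  unfold verF
  rw [andFn_apply c0 (andFn_apply cW (andFn_apply c1 (andFn_apply c2 c3)))]
  simp only [List.cons.injEq, and_true, Bool.and_eq_true, decide_eq_true_eq]
  constructor
  · rintro ⟨hv0, hW0, hm, hlen, hθ⟩
    have hvm : v = paramEnc (fstF v, Nat.pair t κ) := by rw [paramEnc, hones, ← hm]; exact hv0.symm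
    refine ⟨fstF v, t, κ, sndF (sndF W), hvm, hW0.symm, hlen, ?_⟩
    have hfold := length_foldF (pL := pL) (pL' := pL') hr (fstF v) (Nat.pair t κ) t κ (sndF (sndF W))
      (by rw [hlen]; exact Nat.le_mul_of_pos_right _ (by unfold blkLen; positivity))
    have hw' : w = boolPair (paramEnc (fstF v, Nat.pair t κ)) (boolPair (ones t) (boolPair (ones κ) (sndF (sndF W)))) := by
      rw [hw, ← hvm, hW0]
    rw [hw'] at hθ
    rwa [hfold] at hθ
  · rintro ⟨r, t', κ', items, hv', hW', hlen, hθ⟩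
    have ht' : t = t' := by rw [ht, hW']; simp [ones]
    have hκ' : κ = κ' := by rw [hκ, hW']; simp [ones]
    refine ⟨?_, ?_, ?_, ?_, ?_⟩
    · rw [hv']; simp [paramEnc, hones]
    · rw [ht', hκ', hW']; simp
    · rw [hv', ht', hκ']; simp [paramEnc, ParamUniform.length_unaryEncodeNat]
    · rw [hv', ht', hκ']; simpa [paramEnc] using hlen
    · rw [ht', hw, hv', hW',
        length_foldF hr r _ t' κ' items (by rw [hlen]; exact Nat.le_mul_of_pos_right _ (by unfold blkLen; positivity))]
      exact hθ

end Verifier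

/-! ### `L' ∈ NP` -/

/-- Length of a coded list with bounded items. [folklore] -/
theorem length_encList_le_mul {l : List (List Bool)} {A : ℕ} (h : ∀ a ∈ l, a.length ≤ A) :
    (encList l).length ≤ l.length * (2 * A + 2) := by
  induction l with
  | nil => simp [encList]
  | cons a l ih =>
    rw [encList_cons, length_boolPair, List.length_cons, add_mul, one_mul]
    have ha := h a (by simp)
    have hl := ih fun b hb => h b (by simp [hb])
    omega

/-- The certificate-length polynomial. [folklore] -/
def certPoly (pL pL' : Polynomial ℕ) : Polynomial ℕ :=
  4 * X + 4 + 128 * (X + 1) * (2 * (2 * pL + 2 + pL'.comp (2 * pL + 2 + X)) + 2)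

/-- The certificate built from a list of `u(t)` bounded items is short. [folklore] -/
theorem length_cert_le {pL pL' : Polynomial ℕ} {r : List Bool} {t κ : ℕ} {l : List (List Bool)}
    (hl : l.length = tests t) (hla : ∀ a ∈ l, a.length ≤ 2 * pL.eval t + 2 + pL'.eval (2 * pL.eval t + 2 + t)) :
    (boolPair (ones t) (boolPair (ones κ) (encList l))).length ≤
      (certPoly pL pL').eval (paramEnc (r, Nat.pair t κ)).length := by
  have hN : t ≤ (paramEnc (r, Nat.pair t κ)).length ∧ κ ≤ (paramEnc (r, Nat.pair t κ)).length := by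
    simp only [paramEnc, length_boolPair, ParamUniform.length_unaryEncodeNat]
    exact ⟨(Nat.left_le_pair t κ).trans (by omega), (Nat.right_le_pair t κ).trans (by omega)⟩
  set N := (paramEnc (r, Nat.pair t κ)).length with hNdef
  have henc := length_encList_le_mul hla
  rw [hl] at henc
  have hP : pL.eval t ≤ pL.eval N := LCBounds.eval_mono pL hN.1
  have hP' : pL'.eval (2 * pL.eval t + 2 + t) ≤ pL'.eval (2 * pL.eval N + 2 + N) := LCBounds.eval_mono pL' (by omega)
  have hev : (certPoly pL pL').eval N = 4 * N + 4 + 128 * (N + 1) * (2 * (2 * pL.eval N + 2 + pL'.eval (2 * pL.eval N + 2 + N)) + 2) := by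
    simp [certPoly, eval_comp]
  rw [hev, length_boolPair, length_boolPair, ParamUniform.length_ones, ParamUniform.length_ones]
  have hu : tests t ≤ 128 * (N + 1) := by unfold tests; exact Nat.mul_le_mul_left _ (by omega)
  have h1 : tests t * (2 * (2 * pL.eval t + 2 + pL'.eval (2 * pL.eval t + 2 + t)) + 2) ≤
      128 * (N + 1) * (2 * (2 * pL.eval N + 2 + pL'.eval (2 * pL.eval N + 2 + N)) + 2) :=
    Nat.mul_le_mul hu (by omega)
  omega

/-- **Hirahara's `L'` is in `NP`** ("Observe that `{L'_{⟨t,k⟩}}` is in `NP`"): the certificate lists,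
for each coin block, a member of `L_t` hashed to zero with its `L`-certificate; the verifier counts the
valid items against `θ(t)`. [cite: Hirahara2021, Lemma 4.5 (proof, p. 27)] -/
theorem gsLang_mem_NP {L : Language Bool} (hL : L ∈ NP) (pL : Polynomial ℕ) : gsLang L pL ∈ NP := by
  obtain ⟨R, hR, pL', hLR⟩ := hL
  obtain ⟨rr, Mach, hMach⟩ := polyTimeDecidable_iff.1 (mem_P_iff_holds.1 hR)
  have hdec : (fun z : List Bool => encodeBool (R.boolIndicator z)) ∈ FP := ⟨rr, Mach, fun z => hMach z⟩
  set rTest : List Bool → List Bool := fun z => encodeBool (R.boolIndicator z) with hrT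
  have hr : ∀ v, rTest v = [R.boolIndicator v] := fun v => rfl
  have hr1 : OneBit rTest := fun z => ⟨_, rfl⟩
  set R' : Language Bool := {π | verF pL rTest pL' π = [true]} with hR'
  have hR'P : R' ∈ Classes.P := by
    refine mem_P_of_mem_FP (verF_mem_FP hdec hr1) R' fun w => ⟨fun hw => hw, fun hw => ?_⟩
    obtain ⟨b, hb⟩ := oneBit_verF (pL := pL) (rTest := rTest) (pL' := pL') w
    cases b with
    | true => exact absurd hb hw
    | false => exact hb
  refine ⟨R', hR'P, certPoly pL pL', fun v => ⟨fun hv => ?_, fun hv => ?_⟩⟩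
  · -- completeness
    obtain ⟨r, t, κ, rfl, hlen, hθ⟩ := hv
    obtain ⟨l, hl, hla, hcount⟩ := exists_items (L := L) (pL := pL) hLR r t κ (tests t)
    refine ⟨boolPair (ones t) (boolPair (ones κ) (encList l)), length_cert_le hl hla, ?_⟩
    change verF pL rTest pL' (boolPair (paramEnc (r, Nat.pair t κ)) _) = [true]
    rw [verF_eq_true_iff hr]
    exact ⟨r, t, κ, encList l, rfl, rfl, hlen, hθ.trans hcount⟩
  · -- soundness
    obtain ⟨W, -, hW⟩ := hv
    obtain ⟨r, t, κ, items, rfl, -, hlen, hθ⟩ := (verF_eq_true_iff hr v W).1 hW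
    exact ⟨r, t, κ, rfl, hlen, hθ.trans (validCount_le_hitBlocks hLR r t κ items _)⟩

/-! ### The two probability estimates (completeness and soundness of the lower bound test) -/

/-- `exp(-u(t)/128) = e^{-(t+1)}`. [folklore] -/
theorem exp_tests (t : ℕ) : Real.exp (-((tests t : ℕ) : ℝ) / 128) = Real.exp (-((t : ℝ) + 1)) := by
  congr 1; simp [tests]; ring

/-- **Completeness** ("`Pr_r[(r, 1^{⟨t,k⟩}) ∈ L'] ≥ 1 - 2^{-t}` if `|L_t| ≥ 2^k`"): if `|L_t| ≥ 2^κ`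
(and `L_t ⊆ {0,1}^{≤ p_L(t)}`), a uniformly random `r` of the right length misses `L'` with
probability `≤ e^{-(t+1)}`. [cite: Hirahara2021, Lemma 4.5 (proof) with Lemma 4.6 (1)] -/
theorem uniformProb_not_gsLang_le {L : Language Bool} {pL : Polynomial ℕ} {t κ : ℕ}
    (hP : ∀ x ∈ languageSlice L t, x.length ≤ pL.eval t) (hκ : 2 ^ κ ≤ (languageSlice L t).ncard) :
    uniformProb (tests t * blkLen pL t κ) {r | paramEnc (r, Nat.pair t κ) ∉ gsLang L pL} ≤ Real.exp (-((t : ℝ) + 1)) := by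
  have hT : 2 ^ κ ≤ (sliceVec L (pL.eval t) t).card := by rwa [card_sliceVec hP]
  have h := uniformProb_fewHits_le_exp (B := blkLen pL t κ) (u := tests t) (sliceVec L (pL.eval t) t) hT
    (by simp [blkLen, memLen]) (tests_pos t)
  rw [exp_tests] at h
  refine le_trans (le_of_eq (StockMachine.uniformProb_congr fun r hr => ?_)) h
  simp only [Set.mem_setOf_eq, paramEnc_mem_gsLang_iff, hr, true_and, not_le, ← thresh_eq]
  exact_mod_cast Iff.rfl

/-- **Soundness** ("`Pr_r[(r, 1^{⟨t,k⟩}) ∈ L'] < 2^{-t}` if `|L_t| ≤ 2^{k-1}`"): if `2|L_t| ≤ 2^κ`, a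
uniformly random `r` of the right length lands in `L'` with probability `≤ e^{-(t+1)}`.
[cite: Hirahara2021, Lemma 4.5 (proof) with Lemma 4.6 (2)] -/
theorem uniformProb_gsLang_le {L : Language Bool} {pL : Polynomial ℕ} {t κ : ℕ}
    (hP : ∀ x ∈ languageSlice L t, x.length ≤ pL.eval t) (hκ : 2 * (languageSlice L t).ncard ≤ 2 ^ κ) :
    uniformProb (tests t * blkLen pL t κ) {r | paramEnc (r, Nat.pair t κ) ∈ gsLang L pL} ≤ Real.exp (-((t : ℝ) + 1)) := by
  have hT : 2 * (sliceVec L (pL.eval t) t).card ≤ 2 ^ κ := by rwa [card_sliceVec hP]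
  have h := uniformProb_manyHits_le_exp (B := blkLen pL t κ) (u := tests t) (sliceVec L (pL.eval t) t) hT
    (by simp [blkLen, memLen]) (tests_pos t)
  rw [exp_tests] at h
  refine le_trans (le_of_eq (StockMachine.uniformProb_congr fun r hr => ?_)) h
  simp only [Set.mem_setOf_eq, paramEnc_mem_gsLang_iff, hr, true_and, ← thresh_eq]
  exact_mod_cast Iff.rfl


end SLB

end Literature.Computability.MetaComplexity
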